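import Mathlib
import HarnessLib
import HarnessLib.Audit
import Summits.AtomisticToContinuum.Statement
import Literature.MathematicalPhysics.QuantumManyBody.PeriodicBoseGas
import Literature.Probability.LatticeModels.VillainCurrentModel
import HarnessLib.Audit.Status.Attr

/-!
Route: BECVortexSheetPeierls

DORMANT since 2026-08-29T19:26:49Z (census g0: costume|duplicate of —; reader census-reader-34-g0) — unstaffed, not closed; items shared with open routes are served there. `ledger route dormant <id> --off` reactivates.

# Route BECVortexSheetPeierls — coarse-grain once to the healing scale, then vortex-sheet Peierls
order of a Villain current model at stiffness (ρa³)^(-1/2)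

It suffices to show X = X_eng ∧ X_tr ∧ X_bc (card vortex-sheet-duality; conforming re-opening of the
retired gen-1 route
BECVortexSheetDuality, whose only defect was an assembly ending in the Literature decl instead of a
`closes` theorem).
X_eng (decl VillainCurrentLRO, the card's B2 widened to what one coarse-graining step can deliver):
the (3+1)-dimensional
Villain integer-current ("J-current") model
`Literature.Probability.LatticeModels.VillainCurrentModel 3 L M` on the space-time
torus (ℤ/L)³ × ℤ/M with an INHOMOGENEOUS bondwise stiffness field whose spatial values lie in [K,
ΛK], K ≥ K₀(Λ) (temporal
stiffnesses arbitrary), has uniform equal-time block long-range order of the worm two-point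
function: Σ_{x,y} G((x,0),(y,0)) ≥
c(Λ)·L⁶, uniformly in L, M and κ — by GKS-II in current variables (support SliceMonotonicity) this
is exactly the 3-D
inhomogeneous Villain theorem (support SpatialVillainLRO), whose Λ = 1 case is Fröhlich–Spencer 1982
(support
HomogeneousVillainLRO). X_tr (decl HealingScaleTransfer, the card's B1 + B3): X_eng ⇒ constant-mode
condensation
≥ cN for δ-near-minimisers of the periodic N-body energy on the torus of side (N/ρ)^{1/3} at all
small densities (the
PeriodicBEC body, stmt-AtomisticToContinuum-0826 shape). X_bc (decl BoundaryTransferWeak, shared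
verbatim with
stmt-AtomisticToContinuum-0827 and ≈ 20 open torus-first routes): torus condensation ⇒ the
Dirichlet, mode-free
HasGroundStateBEC, i.e. the conjunct.
Lean: `VillainCurrentLRO ∧ HealingScaleTransfer ∧ BoundaryTransferWeak`

## Assembly
Pure logic (Sketch.lean rc 0; axioms propext / Classical.choice / Quot.sound): fix v repulsive
finite-range;
HealingScaleTransfer applied to VillainCurrentLRO gives the PeriodicBEC body for v;
BoundaryTransferWeak turns it into
∃ρ₀ ∀ρ<ρ₀ HasGroundStateBEC v ρ, i.e. the sub-problem Statement decl `BoseEinsteinCondensation`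
(abbrev of the Literature
conjecture). Deciding theorem (glue.lean): `theorem closes (h2 : VillainCurrentLRO) (h3 :
HealingScaleTransfer) (h4 :
BoundaryTransferWeak) : BoseEinsteinCondensation := fun v hv => h4 v hv (h3 h2 v hv)`. The three
support items are the
engine's ladder (HomogeneousVillainLRO ⇐ SpatialVillainLRO, and SpatialVillainLRO →
SliceMonotonicity → VillainCurrentLRO,
both proved in Sketch.lean), not hypotheses of `closes`.

Rationale: WHY THIS LINE. In every positive-weight world-line representation of the Bose gas the one-particle
density matrix is the two-point
function of ONE open world-line, so BEC is worm-end deconfinement; after one super-renormalisable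
coarse-graining step to
Neumann cells of side ℓ between the Gross–Pitaevskii scale and Junge's a(ρa³)^{-1/2-η} — where cell
condensation is now a
PROVED cone fact (neumannBox_condensation_of_energy_le, neumannBox_condensation_firstOrder,
Fournais2020_condensation_holds,
LSSY2005_lowerBound_neumann_holds, LSSY2005_upperBound_periodic_holds) — cell charges and face
crossings form a conserved
integer current whose leading law is the Villain/J-current model (WallinEtAl1994) at stiffness K =
ρξℓ² ≍ (ℓ/ξ)²(ρa³)^{-1/2}
→ ∞: DILUTENESS IS STIFFNESS. GKS-II in current variables (Ginibre1970) reduces equal-time order of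
the (3+1)-D model to
the 3-D Villain model of one time slice, and deep in its ordered phase long-range order follows from
exact abelian duality
plus an energy–entropy (Peierls) bound on the dual ℤ-valued vortex defects costing ≥ (π²/12)K₀ per
plaquette
(FrohlichSpencerCMP1982, Guth1980, KennedyKing1986; RP-free cousins GarbanSpencer2022,
DarioGarban2025, arXiv:2002.02946),
with expansion parameter the defect fugacity e^{-cK} = exp(-c(ρa³)^{-1/2}) instead of an infrared RG
flow to the Bogoliubov
fixed point (Benfatto1994, BalabanEtAl2010 = route BECRenormGroup). Imported, with the card's
explicit dictionary
(world-lines ↦ conserved integer currents; γ(x,y) ↦ worm two-point function; BEC ↦ magnetisation of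
the dual phase; healing
length ↦ lattice spacing; vortex rings ↦ vortex sheets; depletion ↦ O(1/K)): lattice abelian
duality, defect expansions and
correlation inequalities (constructive field theory), the J-current representation of lattice bosons
(now a Lean object:
VillainCurrentModel / PositiveCurrentModel, shared with route
HubbardSuperconductivity/AbelianDuality one dimension down), and
the proved cell theorems of the dilute gas. What no other open route does: BECRenormGroup flows to a
non-trivial fixed point
in a COMPLEX representation; BECInfraredBound, BECThomsonPrinciple and the shell-count family
(BECIroning, BECPhononFloor,
BECLaplacianL1) want an infrared BOUND or floor with no positivity to derive it from; here the
infrared step is a soft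
topological argument in a positive representation, entered at the one scale where condensation is
already a theorem.
Negatives index (6 entries, 2026-08-15): none bears on current models, duality or cell
coarse-graining.

RANKED CRUXES. #2 VillainCurrentLRO (crux) — ENGINE (Literature-grade, independent of the Bose gas;
card item B2 widened to inhomogeneous stiffness, the FIRST crux). For every inhomogeneity ratio Λ ≥
1 there are K₀, c > 0 such that for all L, M ≥ 1, every Villain current model P on (ℤ/L)³ × ℤ/M
(`VillainCurrentModel 3 L M`: one stiffness κ_b > 0 per oriented bond, weights Π_b e^{-J_b²/(2κ_b)}
on divergence-free integer currents) and every K ≥ K₀ such that every SPATIAL bond b (direction ≠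
time) has K ≤ κ_b ≤ ΛK — temporal stiffnesses ARBITRARY positive — one has ofReal(c·L⁶) ≤ Σ_{x,y ∈
(ℤ/L)³} P.twoPoint (x,0) (y,0) (ENNReal; twoPoint = Z(δ_x − δ_y)/Z(0) = ⟨cos(θ_x − θ_y)⟩ of the dual
inhomogeneous Villain rotor model). Why this generality is right: every dual bond factor Σ_n
e^{-n²/2κ_b} cos(n dθ_b) lies in Ginibre's cone, so by GKS-II deleting all bonds outside time-slice
0 only DECREASES the equal-time two-point function (support SliceMonotonicity) — the statement,
uniformly in M and every temporal parameter, is exactly the 3-D inhomogeneous Villain theorem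
(support SpatialVillainLRO) whose Λ = 1 case is FrohlichSpencerCMP1982 (support
HomogeneousVillainLRO); the glue SpatialVillainLRO → SliceMonotonicity → VillainCurrentLRO is proved
in Sketch.lean. J-INDEPENDENT κ_b on purpose: J-dependent "Villain sandwiches" are false
(parity-modulated weights dualise to XY × a ℤ₂ loop gas of fugacity ≈ Λ^{-1/2}: pair order without
worm order for Λ ≳ 45; gen-1 planner), and no Ginibre reduction to Λ = 1 exists inside the Villain
family. [difficulty: L] (why it might fail: No RP, no Ginibre reduction to Λ = 1: FS82's duality +
one-step renormalisation is printed for translation-invariant β; with κ_b ∈ [K, ΛK] the sine-Gordon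
covariance is a ratio-Λ inhomogeneous Green's function and renormalised activities lose translation
symmetry — Λ-uniform constants unproved.) [FrohlichSpencerCMP1982, Guth1980, KennedyKing1986,
BorgsNill1987, Ginibre1970, FrohlichSimonSpencer1976, GarbanSpencer2022, DarioGarban2025,
arXiv:2002.02946, WallinEtAl1994]
#3 HealingScaleTransfer (crux) — THE BET (card items B1 + B3, stated conditionally so that the
deciding theorem is pure logic): VillainCurrentLRO ⇒ the PeriodicBEC body (verbatim the hypothesis
of BoundaryTransferWeak, stmt-0826 shape): for every repulsive finite-range v there is ρ₀ > 0 such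
that for 0 < ρ < ρ₀ there is c > 0 with, eventually in N, some δ > 0 such that every periodic C¹
trial state Ψ on the torus of side (N/ρ)^{1/3} with periodicEnergy ≤ E₀^per + δ has
condensateOccupation ≥ cN. Intended proof (§ Two-layer plan): (i) at fixed (N, L) the
δ-near-minimisers (δ chosen AFTER N) are controlled by the torus ground state = the β → ∞ limit of
e^{-βH^per}; Trotterise imaginary time with step Δτ = θ·ξℓ (ω_p = 1/(ξℓ) the plasma frequency of the
cell lattice; θ = K^{-1/2}) and coarse-grain space into M_c³ Neumann cells of side ℓ = L/M_c, Gξ ≤ ℓ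
≤ a(ρa³)^{-1/2-η}, η < 1/34; cell charges and net face crossings form a divergence-free integer
current on (ℤ/M_c)³ × ℤ/M_t whose law is a POSITIVE push-forward of the symmetrised Feynman–Kac
(Ginibre loop) measure, and Σ_{B,B'} ⟨u_B, γ_Ψ u_{B'}⟩ (u_B = ℓ^{-3/2} 1_B) = M_c³ ·
condensateOccupation is n̄ = ρℓ³ times its block-summed equal-time worm two-point function; (ii)
show that, conditionally on the currents outside any space-time block, the law inside is a mixture
of bondwise Villain weights with spatial stiffness in [K_s, ΛK_s], K_s = θK, K = ρξℓ² ≍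
(ℓ/ξ)²(ρa³)^{-1/2} → ∞ (temporal weights free, thanks to SliceMonotonicity) — the engine is
Λ-uniform and inhomogeneity-tolerant so that it survives conditioning and averaging; inputs, ALL
PROVED in the tree: cell condensation of Bose-symmetric Neumann near-minimisers
(neumannBox_condensation_of_energy_le, neumannBox_condensation_firstOrder;
Fournais2020_condensation_holds on periodic cells) and the energy budget
(LSSY2005_lowerBound_neumann_holds + Lieb–Yngvason superadditivity,
LSSY2005_upperBound_periodic_holds), which make all but o(M_c³) cells condensed with number variance
O(K); (iii) VillainCurrentLRO gives Σ_{x,y} G ≥ cM_c⁶, i.e. condensateOccupation ≥ c·n̄·M_c³ = cN. v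
≡ 0: both sides true (δ < 4π²/L² forces condensateOccupation ≥ N − 1). [deps: VillainCurrentLRO]
[difficulty: open-problem] (why it might fail: The gas's cell-current law need not be a mixture of
bondwise Villain models: intra-cell phonons (ω ≈ ω_p, no adiabatic gap) leave space-time-nonlocal,
possibly signed or non-log-concave weights at O((ξ/ℓ)²) — BFKT's large-field problem; hard cores:
GP-scale cells only; no torus loop measure yet.) [BalabanEtAl2010, BFKT2017, Benfatto1994,
WallinEtAl1994, Fournais2020, LSSY2005, Junge2026, FournaisEtAl2024, Ginibre1970,
FrohlichSpencerCMP1982, Literature.Barriers.AtomisticToContinuum.BogoliubovPerturbationInfrared]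
#4 BoundaryTransferWeak (crux) — SHARED verbatim with stmt-AtomisticToContinuum-0827 (one proof
serves every torus-first route): for each repulsive finite-range v, the PeriodicBEC body for v
(torus of side (N/ρ)^{1/3}, constant-mode occupation ≥ cN for δ-near-minimisers, all small ρ)
implies ∃ρ₀ > 0 ∀ρ ∈ (0, ρ₀) HasGroundStateBEC v ρ (Dirichlet box, λ_max(γ) ≥ cN via
condensateNumber). Not glue: near-minimiser slacks are O(N/L²) while Dirichlet and periodic energies
differ by a wall term ≫ N/L²; expected proof: Neumann bracketing of interior sub-boxes + a mode-free
criterion (λ_max ≥ tr γ²/N). The card is indifferent to boundary conditions beyond this item (its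
engine could run in the Dirichlet box with a free spatial boundary of the current lattice — not
filed). v ≡ 0: both sides true. [deps: HealingScaleTransfer] [difficulty: L] (why it might fail: The
torus hypothesis never fires on the Dirichlet ground state (wall energy ≫ δ above E₀^per; interior
restrictions are neither periodic nor sharp-N): no energy-comparison proof; needs a structural
transfer (Neumann bracketing + mode-free λ_max ≥ tr γ²/N) not in print.) [LSSY2005,
BoccatoSeiringer2023, Basti2022, Junge2026, Fournais2020, LauwersVerbeureZagrebnov2003]
#9 SpatialVillainLRO (support) — THE ENGINE'S REAL CONTENT (its one-slice case M = 1; with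
SliceMonotonicity it gives VillainCurrentLRO back, glue proved in Sketch.lean): for every Λ ≥ 1
there are K₀, c > 0 such that for all L ≥ 1, every `VillainCurrentModel 3 L 1` (one time slice:
temporal bonds are self-loops and drop out of the two-point function, so this IS the 3-D Villain
model on (ℤ/L)³ with bondwise stiffness) and every K ≥ K₀ with K ≤ κ_b ≤ ΛK on spatial bonds:
ofReal(c·L⁶) ≤ Σ_{x,y} twoPoint (x,0) (y,0). Intended proof: FrohlichSpencerCMP1982's duality to the
ℤ-valued locally neutral 2-form (vortex) gas + sine-Gordon + one-step renormalisation
(arXiv:2002.02946 Ch. 3), run with a ratio-Λ uniformly elliptic covariance: Rayleigh monotonicity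
bounds the spin-wave variance by the uniform-K network and a plaquette of vorticity q costs ≥
(π²/12)·min κ·q² (Cauchy–Schwarz over its 4 bonds), so the bare energy–entropy balance is Λ-uniform;
the work is the Λ-uniformity of the renormalised activities. [difficulty: L]
[FrohlichSpencerCMP1982, KennedyKing1986, BorgsNill1987, arXiv:2002.02946, DarioGarban2025]
#9 SliceMonotonicity (support) — GKS-II / GINIBRE IN CURRENT VARIABLES (provable now;
Literature-grade): for every Villain current model P on (ℤ/L)³ × ℤ/M and all spatial sites x, y, the
equal-time two-point function of P dominates that of its time-slice-0 model P₀ : VillainCurrentModel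
3 L 1, P₀.stiffness b := P.stiffness ((b.1.1, 0), b.2): P₀.twoPoint (x,0) (y,0) ≤ P.twoPoint (x,0)
(y,0). Proof on paper: bond-by-bond Fourier (Poisson) duality writes both sides as ⟨cos(θ_x − θ_y)⟩
for rotor measures whose bond factors Σ_n e^{-n²/2κ_b} cos(n dθ_b) are non-negative combinations of
cosines, i.e. lie in Ginibre's cone Q for U(1)^{sites} (Ginibre1970, plane rotators); P's measure is
P₀'s times the factors of all bonds outside slice 0 (all in Q̄), so Griffiths II ⟨cos(θ_x−θ_y) F⟩₀ ≥
⟨cos(θ_x−θ_y)⟩₀⟨F⟩₀ gives the claim (P₀'s temporal self-loops cancel in twoPoint). Current-side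
form: Z(ρ+σ)Z(0) + Z(ρ−σ)Z(0) ≥ 2Z(ρ)Z(σ) for every positive current model. In-tree cousins:
GinibreInequality.lean / GinibreCharacterExpansion.lean (compact-group Ginibre + character duality
for U(1) GAUGE fields); the site version is the same algebra one form-degree down. It removes every
temporal-stiffness, anisotropy and time-continuum hypothesis from the engine. [difficulty: M]
[Ginibre1970, FrohlichSpencerKT1981, WallinEtAl1994]
#9 HomogeneousVillainLRO (support) — MILESTONE 0 = FrohlichSpencerCMP1982 ON THE TORUS (the Λ = 1
case of SpatialVillainLRO, implication proved in Sketch.lean): there are K₀, c > 0 such that for all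
L ≥ 1 and every β ≥ K₀ (β > 0) the homogeneous isotropic 3-D Villain model
`VillainCurrentModel.homogeneous (fun _ => β) _ : VillainCurrentModel 3 L 1` has ofReal(c·L⁶) ≤
Σ_{x,y} twoPoint (x,0) (y,0). In print: Fröhlich–Spencer 1982 (Villain model in ℤ^d, d ≥ 3:
⟨S_0·S_x⟩ = c₀ + O(|x|^{2-d}) for β > β₀(d), quoted as Prop. 1 of arXiv:2002.02946 p. 4 and
re-derived in its Ch. 3, read); the infinite-volume magnetisation is also reachable by RP + infrared
bounds (FrohlichSimonSpencer1976); additions: finite torus, block sums (torus ≥ free box by GKS-II).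
By `VillainCurrentModel.twoPoint_homogeneous` it is the same statement for the real-valued
`PositiveCurrentModel.villain` of the Hubbard sibling file; a prover may land it as a Literature
theorem and cite it here. [difficulty: L] [FrohlichSpencerCMP1982, FrohlichSimonSpencer1976,
Guth1980, arXiv:2002.02946, Wojtkiewicz2012]

TWO-LAYER PLAN. Foreseen glued splits (none filed now; k ≤ 3, depth 1). HealingScaleTransfer ⇐
CellCurrentRepresentation (the block-summed
one-particle density matrix of torus near-minimisers dominates n̄ times the equal-time worm
two-point function of a positive
cell-current law on (ℤ/M_c)³ × ℤ/M_t — needs the torus loop-measure definition requested below) →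
ConditionalVillainStructure
(that law is, conditionally on the outside of any block, a mixture of bondwise Villain models with
spatial κ ∈ [K, ΛK],
K(ρ) → ∞) → HealingScaleTransfer; if (ii) only delivers a wider class 𝒱 (bondwise log-concave even
weights with −log w(J) =
J²/(2κ_b)(1 + O(ε)), or weakly multi-bond weights), the middle child becomes EngineFor𝒱, a widening
of SpatialVillainLRO (NOT
the false J-dependent sandwich); an alternative middle child is GINIBRE DOMINATION (W =
W_{Villain,K} ∗ R̂, R̂ ≥ 0 even, i.e.
dual weight = Villain(K) weight × a Q̄-factor), which by GKS-II needs no robustness theorem at all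
but excludes super-Gaussian
tails. VillainCurrentLRO ⇐ SpatialVillainLRO → SliceMonotonicity → VillainCurrentLRO (children filed
as support; glue =
`engine_of_spatial` of Sketch.lean, to be filed by `route edit --split` when either child closes);
SpatialVillainLRO ⇐
HomogeneousVillainLRO → InhomogeneityByDuality (Λ-uniform Peierls constants over a ratio-Λ elliptic
massless Gaussian) →
SpatialVillainLRO. BoundaryTransferWeak ⇐ NeumannBracketing (interior sub-boxes, −Δ_Dir ≥ ⊕−Δ_Neu, v
≥ 0) → ModeFreeCriterion
(λ_max ≥ tr γ²/N) → BoundaryTransferWeak — shared with every torus-first route (home route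
BECPeriodicReduction retired;
portfolio note on stmt-0827, 2026-08-15T18:41Z: the first tenure planner to move files it once).

KILL CRITERIA. K1: SpatialVillainLRO (hence VillainCurrentLRO) refuted by an explicit 3-D stiffness
field (block order → 0 at arbitrarily
large K₀ for some Λ) ⇒ restate with the homogeneity the periodic gas actually has (Λ = 1 + o(1),
i.e. condition the
transfer on HomogeneousVillainLRO + SliceMonotonicity) or close refuted:VillainCurrentLRO if even
HomogeneousVillainLRO dies
(it would contradict FS82, so that is a formalisation check, not a bet); SliceMonotonicity refuted
would contradict
Ginibre1970 — same status. K2: the CHEAPEST FALSIFIER returns a negative or complex second-order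
effective
current weight at relative order (ξ/ℓ)² that no choice of cell variables / time step removes ⇒
HealingScaleTransfer is back
in BFKT's complex large-field class; close superseded by route BECRenormGroup (the card says so
itself). K3: effective weights positive but parity-modulated (pair hopping comparable to single
hopping at scale ℓ) ⇒ the
delivered class has no worm LRO (ℤ₂ loop-gas obstruction) ⇒ close refuted unless another cell scale
cures it. K4:
BoundaryTransferWeak refuted ⇒ shared pivot with the torus-first family: run the engine in the
Dirichlet box with a free
spatial boundary of the current lattice (the engine's inhomogeneity allowance was kept partly for
this). PeriodicBEC proved
elsewhere moots HealingScaleTransfer but not the engine items, which stay Literature-grade (and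
serve route
HubbardSuperconductivity/AbelianDuality one dimension up).

NOT DECOMPOSED YET. The interior of HealingScaleTransfer: the cell-current REPRESENTATION as a Lean
object (needs a symmetrised Feynman–Kac /
Ginibre loop measure for the PERIODIC N-body gas with an open worm — the tree has the Dirichlet,
distinguishable-particle
machinery GroundStateFeynmanKac.lean but neither the torus nor the permutation sum; requested
below), the conditional-Villain
estimate (Schur complement of intra-cell Bogoliubov modes, choice of θ), the β = ∞ ↔
δ-near-minimiser transfer at fixed (N, L),
the hard-core case (only GP-scale cells, G fixed: K ≍ G²(ρa³)^{-1/2} still → ∞ but cell errors are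
O(G^{-2}), not o(1)), and
the widening of the engine to the delivered class. Positive temperature, d = 2 and the
Dirichlet-direct engine are out of
scope. No third layer will be filed: below the splits above, lemmas ride with `--supports`.

CHEAPEST FALSIFIER. (a) The card's dimer test, hours of kit py (not run by this seat): two
Gross–Pitaevskii cells (two-mode Bose–Hubbard dimer,
n̄ ≫ 1, E_J/E_C = K²) plus ONE intra-cell Bogoliubov mode of frequency ≈ ω_p; integrate the mode out
over a time step
Δτ = θ/ω_p, θ ∈ {1/4, 1, 4}, and read off the effective weight w(J) of transferring J particles:
positive, even and
log-concave with −log w(J) = J²/(2θK)(1 + O((ξ/ℓ)²)), or a negative / complex correction at relative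
order (ξ/ℓ)²? A negative
weight retires HealingScaleTransfer as stated (K2). (b) Lookup: FrohlichSpencerCMP1982 on the
Villain model in d ≥ 3 (not
held; acq-00340 cite-only) — does the defect expansion use translation invariance beyond Gaussian
covariance bounds? If yes,
SpatialVillainLRO is 'heavy' and HomogeneousVillainLRO the realistic first landing (checked today
only via arXiv:2002.02946
p. 4 Prop. 1 and Ch. 3). (c) Lookup: a printed inequality raising Villain stiffness bondwise would
give SpatialVillainLRO ⇐
HomogeneousVillainLRO at once; none exists inside Ginibre1970's cone (f_κ/f_K has negative Fourier
coefficients ≍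
e^{−(κ−K)π²/2}; log θ₃ has negative even cosine coefficients).

NUMBERS. Units ħ = 2m = 1, t := ρa³, Y = 4πt/3, ξ = (8πρa)^{-1/2} = a(8πt)^{-1/2}. Cells: GP window
ℓ = Gξ (G a large constant;
LSSY Thm 5.1 inputs, hard cores allowed) up to Junge's ℓ = a t^{-1/2-η} = √(8π) ξ t^{-η}, η < 1/34
(proved:
neumannBox_condensation_firstOrder gives depletion ≤ C t^{1/17-2η} n per cell;
neumannBox_condensation_of_energy_le gives
n ≤ n₀ + CρaL²Y^{1/17} n + (ℓ²/c)S for energy excess S, and the global budget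
LSSY2005_upperBound_periodic_holds −
Σ_cells LSSY2005_lowerBound_neumann_holds is ≤ CρaN·Y^{1/17}, so all but o(M_c³) cells are condensed
iff (ℓ/ξ)²Y^{1/17} → 0).
Mean occupation n̄ = ρℓ³ ∈ [G³(8π)^{-3/2} t^{-1/2}, t^{-1/2-3η}] ≫ 1 (rotor regime). Josephson data:
E_J ≍ ρℓ, E_C ≍ 8πa/ℓ³,
ω_p = (E_JE_C)^{1/2} = 1/(ξℓ), K = (E_J/E_C)^{1/2} = ρξℓ² ∈ [G²(8π)^{-3/2} t^{-1/2}, (8π)^{-1/2}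
t^{-1/2-2η}] → ∞. Time step
Δτ = θξℓ: K_s = θK, K_t = K/θ, K_sK_t = K², Trotter parameter θ; after SliceMonotonicity ONLY K_s ≥
K₀ matters, i.e.
θ ≥ K₀/K (θ = K^{-1/2}: K_s = K^{1/2} → ∞, Trotter error → 0). Engine side (3-D after the slice
reduction): spin-wave
depletion (1/V)Σ_p 1/(2KΣ_i(1−cos p_i)) = W₃/(2K) (W₃ the Watson-type lattice constant, finite in d
= 3); sheet cost ≥ (π²/12)·min κ per vortex plaquette
(Cauchy–Schwarz over the 4 bonds of a plaquette, each bond in 6 plaquettes), Peierls condition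
e^{−π²K₀/12}·C₄ < 1. Items at open: 7 (3 cruxes, 3 support, 1 assembly).

DEFINITION REQUESTS. (1) LANDED since gen-1:
Literature.Probability.LatticeModels.VillainCurrentModel (bondwise stiffness, ENNReal currentSum /
twoPoint, `currentSum_ofCurried` = the gen-1 inline form) and PositiveCurrentModel — used verbatim
by the four engine-side
items; and the cite fact Junge2026_neumannBox_pinnedLowerBound with the PROVED first-order
Neumann-cell condensation theorems. (2) To file after open,
`--for` HealingScaleTransfer: PeriodicBosonLoopMeasure (topic
Literature/MathematicalPhysics/QuantumManyBody) — the
symmetrised Feynman–Kac (Ginibre 1970 loop-gas) representation of Tr_sym e^{−βH^per_N} and of its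
one-particle density
matrix on the torus ℝ³/Lℤ³: periodised Brownian bridges, permutation sum, one open worm; positivity
of the weights as a
theorem; without it CellCurrentRepresentation (layer 2) cannot be typed. (3) Cite fact wanted (not
blocking):
FrohlichSpencerCMP1982's d ≥ 3 Villain magnetisation theorem as a named Literature Prop next to
PositiveCurrentModel (would
let a grounder stamp HomogeneousVillainLRO 'known modulo the finite-torus block form').

Novelty: Searches (2026-08-15, this seat; local searchd intermittently DOWN, OpenAlex/S2 HTTP 429, so
crossref + arXiv + galaxy +
graph): `lit frontier AtomisticToContinuum --since 2022` (30 rows: arXiv:2510.20493,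
arXiv:2603.20776, arXiv:2602.16566,
arXiv:2605.06844 … — no duality / current-representation work on BEC); `lit galaxy search "Massless
phases and symmetry
restoration" --star all` (10 rows: Montvay–Münster, Malyshev–Minlos, Dario HDR, Peled–Spinka
arXiv:1708.00058, Dario–Wu
arXiv:2002.02946 — read pp. 1–6: FS82 = duality to a lattice Coulomb gas + one renormalisation step,
Prop. 1); `lit galaxy
search "Villain model spontaneous magnetization three dimensions Peierls argument vortex" --star
all` (0); crossref
"superfluid vortex world-sheet duality four dimensions lattice boson" (8:
doi:10.1209/0295-5075/77/47005 Franz 2007,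
doi:10.1088/1367-2630/13/3/033004 Beekman–Sadri–Zaanen 2011 — physics-level (3+1)-D vortex–boson
duality, no theorem);
crossref "quantum rotor model long-range order ground state duality Peierls" (8: only
doi:10.1016/j.physa.2012.06.028
Wojtkiewicz2012, by RP); crossref "dilute Bose gas condensation thermodynamic limit renormalization
group" (7, textbook
chapters); arXiv "Villain model duality long-range order" (0), arXiv "Bose gas condensation
thermodynamic limit" ≥ 2023 (1,
irrelevant); `lit read doi:10.1007/bf01213610` (not held → acq-00340 cite-only). Plus the card's log
and THREE refuter
novelty audits of the gen-1 route/card (audits 3/14/32: crossr  [refs: 10.1209/0295-5075/77/47005, 10.1088/1367-2630/13/3/033004, 10.1016/j.physa.2012.06.028, 10.1007/bf01213610`, 2510.20493, 2603.20776, 2602.16566, 2605.06844, 1708.00058, 2002.02946, doi:10.1209/0295-5075/77/47005, doi:10.1088/1367-2630/13/3/033004, doi:10.1016/j.physa.2012.06.028, doi:10.1007/bf01213610, Wojtkiewicz2012, FrohlichSpencerCMP1982, Guth1980, KennedyKing1986, WallinEtAl1994, Fournais202]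

Barriers (technique_class: duality, Peierls, coarse-graining, current-representation): - technique_class: duality, Peierls, coarse-graining, current-representation
- Literature.Barriers.AtomisticToContinuum.BogoliubovPerturbationInfrared: evaded for the order
parameter — beyond scale ℓ nothing is expanded around Bogoliubov; the expansion parameter is the
sheet fugacity e^{−cK} and the marginal d = 3 logarithms live in amplitude correlations that block
LRO does not need. Honest: it re-enters INSIDE HealingScaleTransfer (one super-renormalisable step;
positivity of the conditional cell-current weights is the bet, kill K2), shared with route
BECRenormGroup and not evaded there.
- Literature.Barriers.AtomisticToContinuum.KineticGapLengthScales: used only inside Neumann cells of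
side ℓ ≤ a(ρa³)^{-1/2-η}, exactly the window where it is a PROVED theorem
(neumannBox_condensation_firstOrder, Fournais2020_condensation_holds); inter-cell coherence comes
from the engine, which has no gap and no ℓ² loss; the barrier's decl LSSY2005_thm51_periodic is a
cousin input never applied at L = (N/ρ)^{1/3}, and the narrowed class (energy-window-only arguments)
does not contain a proof that uses the positivity of the path measure.
- Literature.Barriers.AtomisticToContinuum.HalfFillingReflectionPositivity: evaded — no reflection
positivity anywhere; VillainCurrentLRO is stated for inhomogeneous stiffness precisely so that its
proof must be the RP-free duality/Peierls argument; commensurate filling is not needed because n̄ ≫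
1 (rotor regime, the constraint n_B ≥ 0 is e^{−cn̄²/K}-invisib

History (route lifecycle, newest last):
- 2026-08-16T15:30:45Z · rev 3: restated Assembly (stmt-AtomisticToContinuum-13471 proved) — @edit_note.txt (planner-rground-AtomisticToContinuum-BECVortexS-326282a2-0)
- 2026-08-25T02:43:27Z · DORMANT — reconciler: no traction for 7.3 d (last activity item-evidence-added at 2026-08-17T18:55:01Z); parked, not closed — `ledger route dormant route-AtomisticToConti (operator:999:3848920)
- 2026-08-29T03:31:10Z · REACTIVATED — reconciler: reactivated — activity statement-checked at 2026-08-29T01:17:37Z after parking at 2026-08-25T02:43:27Z (operator:999:426693)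
- 2026-08-29T19:26:49Z · DORMANT — census g0: costume|duplicate of —; reader census-reader-34-g0 (operator:999:872582)

sub-problem: BoseEinsteinCondensation · status: dormant · opened planner-plancard-AtomisticToContinuum-BoseEin-c4376ad1-g2-0 2026-08-15T19:16:34Z · rev 4 · ledger route-AtomisticToContinuum-BECVortexSheetPeierls
GENERATED by the gate from the ledger (D-0016/17). Provers cite these decls: `theorem foo : Summit.AtomisticToContinuum.BoseEinsteinCondensation.Theses.BECVortexSheetPeierls.<Decl> := …` in Summits/AtomisticToContinuum/BoseEinsteinCondensation/Theorems/<Name>.lean.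
-/

namespace Summit.AtomisticToContinuum.BoseEinsteinCondensation.Theses.BECVortexSheetPeierls

open scoped BigOperators Topology Manifold Classical MeasureTheory ProbabilityTheory Matrix InnerProductSpace ComplexConjugate ContinuousMap
open Filter Set Function TopologicalSpace MeasureTheory

attribute [summit_statement] _root_.BoseEinsteinCondensation

/-- item stmt-AtomisticToContinuum-13466 · crux · rank 2 · open · by planner
why it might fail: No RP, no Ginibre reduction to Λ = 1: FS82's duality + one-step renormalisation is printed for translation-invariant β; with κ_b ∈ [K, ΛK] the sine-Gordon covariance is a ratio-Λ inhomogeneous Green's function and renormalised activities lose translation symmetry — Λ-uniform constants unproved.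
sources: FrohlichSpencerCMP1982, Guth1980, KennedyKing1986, BorgsNill1987, Ginibre1970, FrohlichSimonSpencer1976
[crux] ENGINE (Literature-grade, independent of the Bose gas; card item B2 widened to inhomogeneous
stiffness, the FIRST crux). For every inhomogeneity ratio Λ ≥ 1 there are K₀, c > 0 such that for
all L, M ≥ 1, every Villain current model P on (ℤ/L)³ × ℤ/M (`VillainCurrentModel 3 L M`: one
stiffness κ_b > 0 per oriented bond, weights Π_b e^{-J_b²/(2κ_b)} on divergence-free integer
currents) and every K ≥ K₀ such that every SPATIAL bond b (direction ≠ time) has K ≤ κ_b ≤ ΛK —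
temporal stiffnesses ARBITRARY positive — one has ofReal(c·L⁶) ≤ Σ_{x,y ∈ (ℤ/L)³} P.twoPoint (x,0)
(y,0) (ENNReal; twoPoint = Z(δ_x − δ_y)/Z(0) = ⟨cos(θ_x − θ_y)⟩ of the dual inhomogeneous Villain
rotor model). Why this generality is right: every dual bond factor Σ_n e^{-n²/2κ_b} cos(n dθ_b) lies
in Ginibre's cone, so by GKS-II deleting all bonds outside time-slice 0 only DECREASES the
equal-time two-point function (support SliceMonotonicity) — the statement, uniformly in M and every
temporal parameter, is exactly the 3-D inhomogeneous Villain theorem (support SpatialVillainLRO)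
whose Λ = 1 case is FrohlichSpencerCMP1982 (support HomogeneousVillainLRO); the glue
SpatialVillainLRO → SliceMonotonicity → VillainC -/
@[route_item "route-AtomisticToContinuum-BECVortexSheetPeierls", crux]
def VillainCurrentLRO : Prop :=
  ∀ Λ : ℝ, 1 ≤ Λ → ∃ K₀ c : ℝ, 0 < c ∧ ∀ (L M : ℕ) [NeZero L] [NeZero M] (P : Literature.Probability.LatticeModels.VillainCurrentModel 3 L M) (K : ℝ), K₀ ≤ K → (∀ b, b.2 ≠ none → K ≤ P.stiffness b ∧ P.stiffness b ≤ Λ * K) → ENNReal.ofReal (c * (L : ℝ) ^ 6) ≤ ∑ x : Literature.Probability.LatticeModels.TorusSite 3 L, ∑ y : Literature.Probability.LatticeModels.TorusSite 3 L, P.twoPoint (x, 0) (y, 0)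

/-- item stmt-AtomisticToContinuum-13467 · crux · rank 3 · open · by planner
why it might fail: The gas's cell-current law need not be a mixture of bondwise Villain models: intra-cell phonons (ω ≈ ω_p, no adiabatic gap) leave space-time-nonlocal, possibly signed or non-log-concave weights at O((ξ/ℓ)²) — BFKT's large-field problem; hard cores: GP-scale cells only; no torus loop measure yet.
sources: BalabanEtAl2010, BFKT2017, Benfatto1994, WallinEtAl1994, Fournais2020, LSSY2005
[crux] THE BET (card items B1 + B3, stated conditionally so that the deciding theorem is pure
logic): VillainCurrentLRO ⇒ the PeriodicBEC body (verbatim the hypothesis of BoundaryTransferWeak,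
stmt-0826 shape): for every repulsive finite-range v there is ρ₀ > 0 such that for 0 < ρ < ρ₀ there
is c > 0 with, eventually in N, some δ > 0 such that every periodic C¹ trial state Ψ on the torus of
side (N/ρ)^{1/3} with periodicEnergy ≤ E₀^per + δ has condensateOccupation ≥ cN. Intended proof (§
Two-layer plan): (i) at fixed (N, L) the δ-near-minimisers (δ chosen AFTER N) are controlled by the
torus ground state = the β → ∞ limit of e^{-βH^per}; Trotterise imaginary time with step Δτ = θ·ξℓ
(ω_p = 1/(ξℓ) the plasma frequency of the cell lattice; θ = K^{-1/2}) and coarse-grain space into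
M_c³ Neumann cells of side ℓ = L/M_c, Gξ ≤ ℓ ≤ a(ρa³)^{-1/2-η}, η < 1/34; cell charges and net face
crossings form a divergence-free integer current on (ℤ/M_c)³ × ℤ/M_t whose law is a POSITIVE
push-forward of the symmetrised Feynman–Kac (Ginibre loop) measure, and Σ_{B,B'} ⟨u_B, γ_Ψ u_{B'}⟩
(u_B = ℓ^{-3/2} 1_B) = M_c³ · condensateOccupation is n̄ = ρℓ³ times its block-summed equal-time
worm two-point functi -/
@[route_item "route-AtomisticToContinuum-BECVortexSheetPeierls", crux]
def HealingScaleTransfer : Prop :=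
  VillainCurrentLRO → ∀ v : ℝ → ENNReal, Literature.MathematicalPhysics.QuantumManyBody.BoseGas.IsRepulsiveFiniteRange v → ∃ ρ₀ : ℝ, 0 < ρ₀ ∧ ∀ ρ : ℝ, 0 < ρ → ρ < ρ₀ → ∃ c : ℝ, 0 < c ∧ ∀ᶠ N : ℕ in Filter.atTop, ∃ δ : ENNReal, 0 < δ ∧ ∀ Ψ : Literature.MathematicalPhysics.QuantumManyBody.BoseGas.PeriodicTrialState N (Literature.MathematicalPhysics.QuantumManyBody.BoseGas.sideLength ρ N), Literature.MathematicalPhysics.QuantumManyBody.BoseGas.periodicEnergy v Ψ ≤ Literature.MathematicalPhysics.QuantumManyBody.BoseGas.periodicGroundStateEnergy v N (Literature.MathematicalPhysics.QuantumManyBody.BoseGas.sideLength ρ N) + δ → ENNReal.ofReal (c * N) ≤ Literature.MathematicalPhysics.QuantumManyBody.BoseGas.condensateOccupation N (Literature.MathematicalPhysics.QuantumManyBody.BoseGas.sideLength ρ N) Ψ.ψ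

/-- item stmt-AtomisticToContinuum-0827 · crux · rank 4 · open · by planner
why it might fail: The torus hypothesis never fires on the Dirichlet ground state (wall energy ≫ δ above E₀^per; interior restrictions are neither periodic nor sharp-N): no energy-comparison proof; needs a structural transfer (Neumann bracketing + mode-free λ_max ≥ tr γ²/N) not in print.
sources: LSSY2005, BoccatoSeiringer2023, Basti2022, Junge2026, Fournais2020, LauwersVerbeureZagrebnov2003
[crux] BoundaryTransferWeak (mode-free boundary-condition transfer, per potential): for each
repulsive finite-range v, PeriodicBEC(v) implies ∃ρ₀>0 ∀ρ∈(0,ρ₀) HasGroundStateBEC v ρ (Dirichlet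
ground state, λ_max(γ) ≥ cN via condensateNumber). Not glue: near-minimiser slacks are O(N/L²) while
Dirichlet/periodic energies differ by a boundary term ≫ N/L², so no energy-comparison proof;
expected route: Neumann bracketing of interior sub-boxes (−Δ_Dir ≥ ⊕−Δ_Neu, v ≥ 0) + a mode-free
criterion (λ_max ≥ tr γ²/N). Only the ENERGY analogue is in print (LiebSeiringerSolovejYngvason2005
Ch. 2 after (2.8)). v ≡ 0: hypothesis and conclusion both true. -/
@[route_item "route-AtomisticToContinuum-BECVortexSheetPeierls", crux]
def BoundaryTransferWeak : Prop :=
  ∀ v : ℝ → ENNReal, Literature.MathematicalPhysics.QuantumManyBody.BoseGas.IsRepulsiveFiniteRange v → (∃ ρ₀ : ℝ, 0 < ρ₀ ∧ ∀ ρ : ℝ, 0 < ρ → ρ < ρ₀ → ∃ c : ℝ, 0 < c ∧ ∀ᶠ N : ℕ in Filter.atTop, ∃ δ : ENNReal, 0 < δ ∧ ∀ Ψ : Literature.MathematicalPhysics.QuantumManyBody.BoseGas.PeriodicTrialState N (Literature.MathematicalPhysics.QuantumManyBody.BoseGas.sideLength ρ N), Literature.MathematicalPhysics.QuantumManyBody.BoseGas.periodicEnergy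 v Ψ ≤ Literature.MathematicalPhysics.QuantumManyBody.BoseGas.periodicGroundStateEnergy v N (Literature.MathematicalPhysics.QuantumManyBody.BoseGas.sideLength ρ N) + δ → ENNReal.ofReal (c * N) ≤ Literature.MathematicalPhysics.QuantumManyBody.BoseGas.condensateOccupation N (Literature.MathematicalPhysics.QuantumManyBody.BoseGas.sideLength ρ N) Ψ.ψ) → ∃ ρ₀ : ℝ, 0 < ρ₀ ∧ ∀ ρ : ℝ, 0 < ρ → ρ < ρ₀ → Literature.MathematicalPhysics.QuantumManyBody.BoseGas.HasGroundStateBEC v ρ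

/-- item stmt-AtomisticToContinuum-13468 · support · rank 9 · closed · proved by Summit.AtomisticToContinuum.BoseEinsteinCondensation.Theorems.spatialVillainLRO_proof_gs @ d57497e8da1e (prover) · by planner
sources: FrohlichSpencerCMP1982, KennedyKing1986, BorgsNill1987, arXiv:2002.02946, DarioGarban2025
[support] THE ENGINE'S REAL CONTENT (its one-slice case M = 1; with SliceMonotonicity it gives
VillainCurrentLRO back, glue proved in Sketch.lean): for every Λ ≥ 1 there are K₀, c > 0 such that
for all L ≥ 1, every `VillainCurrentModel 3 L 1` (one time slice: temporal bonds are self-loops and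
drop out of the two-point function, so this IS the 3-D Villain model on (ℤ/L)³ with bondwise
stiffness) and every K ≥ K₀ with K ≤ κ_b ≤ ΛK on spatial bonds: ofReal(c·L⁶) ≤ Σ_{x,y} twoPoint
(x,0) (y,0). Intended proof: FrohlichSpencerCMP1982's duality to the ℤ-valued locally neutral 2-form
(vortex) gas + sine-Gordon + one-step renormalisation (arXiv:2002.02946 Ch. 3), run with a ratio-Λ
uniformly elliptic covariance: Rayleigh monotonicity bounds the spin-wave variance by the uniform-K
network and a plaquette of vorticity q costs ≥ (π²/12)·min κ·q² (Cauchy–Schwarz over its 4 bonds),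
so the bare energy–entropy balance is Λ-uniform; the work is the Λ-uniformity of the renormalised
activities. [difficulty: L] -/
@[route_item "route-AtomisticToContinuum-BECVortexSheetPeierls", crux]
def SpatialVillainLRO : Prop :=
  ∀ Λ : ℝ, 1 ≤ Λ → ∃ K₀ c : ℝ, 0 < c ∧ ∀ (L : ℕ) [NeZero L] (P : Literature.Probability.LatticeModels.VillainCurrentModel 3 L 1) (K : ℝ), K₀ ≤ K → (∀ b, b.2 ≠ none → K ≤ P.stiffness b ∧ P.stiffness b ≤ Λ * K) → ENNReal.ofReal (c * (L : ℝ) ^ 6) ≤ ∑ x : Literature.Probability.LatticeModels.TorusSite 3 L, ∑ y : Literature.Probability.LatticeModels.TorusSite 3 L, P.twoPoint (x, 0) (y, 0)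

-- `SpatialVillainLRO` holds: proved by `Summit.AtomisticToContinuum.BoseEinsteinCondensation.Theorems.spatialVillainLRO_proof_gs` @ d57497e8da1e (its module imports this route file, so no `_holds` link can be stated here).

/-- item stmt-AtomisticToContinuum-13469 · support · rank 9 · closed · proved by Summit.AtomisticToContinuum.BoseEinsteinCondensation.Theorems.SliceMonotonicity_proof @ adb35102f991 (prover) · by planner
sources: Ginibre1970, FrohlichSpencerKT1981, WallinEtAl1994
[support] GKS-II / GINIBRE IN CURRENT VARIABLES (provable now; Literature-grade): for every Villain
current model P on (ℤ/L)³ × ℤ/M and all spatial sites x, y, the equal-time two-point function of P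
dominates that of its time-slice-0 model P₀ : VillainCurrentModel 3 L 1, P₀.stiffness b :=
P.stiffness ((b.1.1, 0), b.2): P₀.twoPoint (x,0) (y,0) ≤ P.twoPoint (x,0) (y,0). Proof on paper:
bond-by-bond Fourier (Poisson) duality writes both sides as ⟨cos(θ_x − θ_y)⟩ for rotor measures
whose bond factors Σ_n e^{-n²/2κ_b} cos(n dθ_b) are non-negative combinations of cosines, i.e. lie
in Ginibre's cone Q for U(1)^{sites} (Ginibre1970, plane rotators); P's measure is P₀'s times the
factors of all bonds outside slice 0 (all in Q̄), so Griffiths II ⟨cos(θ_x−θ_y) F⟩₀ ≥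
⟨cos(θ_x−θ_y)⟩₀⟨F⟩₀ gives the claim (P₀'s temporal self-loops cancel in twoPoint). Current-side
form: Z(ρ+σ)Z(0) + Z(ρ−σ)Z(0) ≥ 2Z(ρ)Z(σ) for every positive current model. In-tree cousins:
GinibreInequality.lean / GinibreCharacterExpansion.lean (compact-group Ginibre + character duality
for U(1) GAUGE fields); the site version is the same algebra one form-degree down. It removes every
temporal-stiffness, anisotropy and time-contin -/
@[route_item "route-AtomisticToContinuum-BECVortexSheetPeierls", crux]
def SliceMonotonicity : Prop :=
  ∀ (L M : ℕ) [NeZero L] [NeZero M] (P : Literature.Probability.LatticeModels.VillainCurrentModel 3 L M) (x y : Literature.Probability.LatticeModels.TorusSite 3 L), (⟨fun b => P.stiffness ((b.1.1, 0), b.2), fun _ => P.stiffness_pos _⟩ : Literature.Probability.LatticeModels.VillainCurrentModel 3 L 1).twoPoint (x, 0) (y, 0) ≤ P.twoPoint (x, 0) (y, 0)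

-- `SliceMonotonicity` holds: proved by `Summit.AtomisticToContinuum.BoseEinsteinCondensation.Theorems.SliceMonotonicity_proof` @ adb35102f991 (its module imports this route file, so no `_holds` link can be stated here).

/-- item stmt-AtomisticToContinuum-13470 · support · rank 9 · closed · proved by Summit.AtomisticToContinuum.BoseEinsteinCondensation.Theorems.HomogeneousVillainLRO_proof @ 55b3949722b8 (prover) · by planner
sources: FrohlichSpencerCMP1982, FrohlichSimonSpencer1976, Guth1980, arXiv:2002.02946, Wojtkiewicz2012
[support] MILESTONE 0 = FrohlichSpencerCMP1982 ON THE TORUS (the Λ = 1 case of SpatialVillainLRO,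
implication proved in Sketch.lean): there are K₀, c > 0 such that for all L ≥ 1 and every β ≥ K₀ (β
> 0) the homogeneous isotropic 3-D Villain model `VillainCurrentModel.homogeneous (fun _ => β) _ :
VillainCurrentModel 3 L 1` has ofReal(c·L⁶) ≤ Σ_{x,y} twoPoint (x,0) (y,0). In print:
Fröhlich–Spencer 1982 (Villain model in ℤ^d, d ≥ 3: ⟨S_0·S_x⟩ = c₀ + O(|x|^{2-d}) for β > β₀(d),
quoted as Prop. 1 of arXiv:2002.02946 p. 4 and re-derived in its Ch. 3, read); the infinite-volume
magnetisation is also reachable by RP + infrared bounds (FrohlichSimonSpencer1976); additions: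
finite torus, block sums (torus ≥ free box by GKS-II). By `VillainCurrentModel.twoPoint_homogeneous`
it is the same statement for the real-valued `PositiveCurrentModel.villain` of the Hubbard sibling
file; a prover may land it as a Literature theorem and cite it here. [difficulty: L] -/
@[route_item "route-AtomisticToContinuum-BECVortexSheetPeierls", crux]
def HomogeneousVillainLRO : Prop :=
  ∃ K₀ c : ℝ, 0 < c ∧ ∀ (L : ℕ) [NeZero L] (β : ℝ) (hβ : 0 < β), K₀ ≤ β → ENNReal.ofReal (c * (L : ℝ) ^ 6) ≤ ∑ x : Literature.Probability.LatticeModels.TorusSite 3 L, ∑ y : Literature.Probability.LatticeModels.TorusSite 3 L, (Literature.Probability.LatticeModels.VillainCurrentModel.homogeneous (fun _ => β) (fun _ => hβ) : Literature.Probability.LatticeModels.VillainCurrentModel 3 L 1).twoPoint (x, 0) (y, 0)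

-- `HomogeneousVillainLRO` holds: proved by `Summit.AtomisticToContinuum.BoseEinsteinCondensation.Theorems.HomogeneousVillainLRO_proof` @ 55b3949722b8 (its module imports this route file, so no `_holds` link can be stated here).

-- earlier Assembly (stmt-AtomisticToContinuum-13471, replaced 2026-08-16T15:30:45Z -> stmt-AtomisticToContinuum-15366): proved by Summit.AtomisticToContinuum.BoseEinsteinCondensation.Theorems.becVortexSheetPeierls_assembly_proof — VillainCurrentLRO → HealingScaleTransfer → BoundaryTransferWeak → _root_.BoseEinsteinCondensation
/-- item stmt-AtomisticToContinuum-15366 · assembly · rank 1 · closed · proved by Summit.AtomisticToContinuum.BoseEinsteinCondensation.Theorems.becVortexSheetPeierls_assembly_proof @ 99756936d619 (prover) · by planner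
sources: LSSY2005, FrohlichSpencerCMP1982
[assembly] Frame statement X_open → Statement, X_open = the two cruxes that are NOT yet theorems of
the tree: HealingScaleTransfer → BoundaryTransferWeak → BoseEinsteinCondensation. The engine crux
VillainCurrentLRO is supplied INSIDE the proof — it is now a theorem of the tree,
`Theorems.villainCurrentLRO_of_homogeneousVillainLRO
Theorems.homogeneousVillainLRO_of_garbanSpencer`
(Theorems/BECVortexSheetPeierlsVillainCurrentLROGlue.lean +
Theorems/BECVortexSheetPeierlsSpatialVillainLROFromGS.lean: Garban–Spencer 2022 long-range order of
the Villain rotator on the torus, AHPS/Ginibre stiffness monotonicity, SliceMonotonicity). Proof,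
provable now in one line (planner Sketch2.lean rc 0, axioms propext/Classical.choice/Quot.sound):
`fun h3 h4 => closes (Theorems.villainCurrentLRO_of_homogeneousVillainLRO
Theorems.homogeneousVillainLRO_of_garbanSpencer) h3 h4`. Restated (route-repair, ground-failed,
2026-08-16) from the rev-2 form `VillainCurrentLRO → HealingScaleTransfer → BoundaryTransferWeak →
BoseEinsteinCondensation`, which is binder-for-binder the type of `closes` and — because
HealingScaleTransfer := VillainCurrentLRO → PB-body and BoundaryTransferWeak := ∀ v, PB-body v → … —
a t -/
@[route_item "route-AtomisticToContinuum-BECVortexSheetPeierls"]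
def Assembly : Prop :=
  HealingScaleTransfer → BoundaryTransferWeak → _root_.BoseEinsteinCondensation

-- `Assembly` holds: proved by `Summit.AtomisticToContinuum.BoseEinsteinCondensation.Theorems.becVortexSheetPeierls_assembly_proof` @ 99756936d619 (its module imports this route file, so no `_holds` link can be stated here).

/-! D-0027 §2.1 — DECIDING THEOREM (planner-authored via `route open/edit --closes-file`; by planner-plancard-AtomisticToContinuum-BoseEin-c4376ad1-g2-0 2026-08-15T19:16:34Z):
its hypotheses are this route's items and its conclusion the sub-problem Statement (glue_lint), and it elaborates with this file. -/

@[closes "route-AtomisticToContinuum-BECVortexSheetPeierls"] theorem closes (h2 : VillainCurrentLRO) (h3 : HealingScaleTransfer) (h4 : BoundaryTransferWeak) : _root_.BoseEinsteinCondensation :=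
  fun v hv => h4 v hv (h3 h2 v hv)

end Summit.AtomisticToContinuum.BoseEinsteinCondensation.Theses.BECVortexSheetPeierls
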